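import Literature.NumberTheory.Transcendental.NesterenkoUResultantArchBound
import Literature.NumberTheory.Transcendental.NesterenkoUResultantIntCoeffs
import Literature.NumberTheory.Transcendental.NesterenkoEvalBounds
import Mathlib.Analysis.Complex.Exponential
import HarnessLib

/-!
# The `u`-resultant of the Chow form of a prime with a form, VIII: the height (LNM 1752 Ch. 3 Prop. 4.11 2), route B)

`Literature/NumberTheory/Transcendental/NesterenkoUResultantHeight.lean`. For a homogeneous prime
`𝔭 ⊂ ℚ[x₀, …, x_m]` of rank `s + 1` (`2 ≤ s + 1 ≤ m`), its associated form `F` (`D = deg 𝔭`),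
a form `Q ∉ 𝔭` of degree `d ≥ 1` with PRIMITIVE integer model `Q₀` (`Q = q Q₀`), and the
`u`-resultant `G = uResultant 𝔭 s d Q₀`, we prove part 2) of Proposition 4.11 for `G` (whose
height is that of the unmixed ideal `J` of `NesterenkoUResultantChow.lean`):

  `h(G) ≤ d · h(𝔭) + D · h(Q) + m (s + 2) D d`        (`height_uResultant_le`; `r = s + 1`).

Proof: `G = λ^d G₀` with `G₀ ∈ ℤ[u]` (`NesterenkoUResultantIntCoeffs.lean`), so
`h(G) = h(G₀) ≤ log |G₀|_∞ = log |G|_∞ − d log |λ|` (`height_map_le_log_maxNorm`); `|G|_∞` is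
bounded by a value `|G(z⋆)|` on the unit torus (`exists_eval_ge_maxNorm`), hence by
`‖Q₀‖₁^D (e^{mD} |F(z⋆; ·)|)^d` (`norm_aeval_uResultant_le`), with `|F(z⋆; ·)| ≤ #supp F · |F|`
(`maxNorm_map_aeval_splitLast_le`), `#supp F ≤ (m+1)^{(s+1)D}` (`card_support_chowForm_le_pow`),
`‖Q₀‖₁ ≤ (m+1)^d |Q₀|`, `log |Q₀| = h(Q)`, `log |F| = log |λ| + h(𝔭)`; the elementary
inequality `(s+2) log(m+1) + m ≤ m(s+2)` (`m ≥ 2`) closes the constant.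

No definitions, no named facts.

## References

* [NesterenkoPhilippon2001] Yu. V. Nesterenko, P. Philippon (eds.), *Introduction to Algebraic
  Independence Theory*, LNM 1752, Springer 2001, Ch. 3 §4, Def. 4.2, 4.5 (p. 38), Prop. 4.11 2)
  (p. 41).
* [Nes10] Yu. V. Nesterenko, Proc. Steklov Inst. Math. 218 (1997) 294–331, Prop. 1.4.
-/

noncomputable section

open MvPolynomial
open Literature.NumberTheory.Transcendental.PhilipponMain

attribute [local instance] MvPolynomial.gradedAlgebra

namespace Literature.NumberTheory.Transcendental

namespace Nesterenko

variable {m : ℕ}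

/-! ### Counting the monomials of the Chow form block by block -/

/-- The restriction of an exponent to the block `uᵢ`. [folklore] -/
theorem degree_blockRestrict {r : ℕ} (γ : Fin r × Fin (m + 1) →₀ ℕ) (i : Fin r) :
    (Finsupp.equivFunOnFinite.symm fun j : Fin (m + 1) => γ (i, j)).degree = bdeg i γ := by
  rw [Finsupp.degree_eq_sum, bdeg]
  exact Finset.sum_congr rfl fun j _ => by simp

/-- **`#supp F ≤ (m+1)^{r · deg I}`** for an associated form of index `r` (it is homogeneous of
degree `deg I` in each of the `r` blocks of `m + 1` variables). [cite: NesterenkoPhilippon2001,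
Ch. 3, remark after Prop. 4.4 (p. 38)] -/
theorem card_support_chowForm_le_pow (I : Ideal (Rx m)) {r : ℕ} (hr : 0 < r) :
    (chowForm I r).support.card ≤ (m + 1) ^ (r * ideg I r) := by
  classical
  set S := Fintype.piFinset fun _ : Fin r => degMonomials (m + 1) (ideg I r) with hS
  have hmaps : ∀ γ ∈ (chowForm I r).support,
      (fun i : Fin r => Finsupp.equivFunOnFinite.symm fun j : Fin (m + 1) => γ (i, j)) ∈ S := by
    intro γ hγ
    rw [hS, Fintype.mem_piFinset]
    intro i
    exact mem_degMonomials (by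
      rw [degree_blockRestrict, bdeg_eq_ideg_of_mem_support_chowForm I hr hγ i])
  have hinj : Set.InjOn
      (fun (γ : Fin r × Fin (m + 1) →₀ ℕ) (i : Fin r) =>
        Finsupp.equivFunOnFinite.symm fun j : Fin (m + 1) => γ (i, j))
      (chowForm I r).support := by
    intro γ _ γ' _ h
    ext ⟨i, j⟩
    have := congrArg (fun f => f i j) h
    simpa using this
  calc (chowForm I r).support.card ≤ S.card := Finset.card_le_card_of_injOn _ hmaps hinj
    _ = ∏ _i : Fin r, (degMonomials (m + 1) (ideg I r)).card := Fintype.card_piFinset _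
    _ ≤ ∏ _i : Fin r, (m + 1) ^ ideg I r :=
        Finset.prod_le_prod' fun i _ => card_degMonomials_le _ _
    _ = (m + 1) ^ (r * ideg I r) := by
        rw [Finset.prod_const, Finset.card_univ, Fintype.card_fin, ← pow_mul, mul_comm]

/-! ### Norms of integer and rational polynomials seen in `ℂ` -/

/-- `|map P| = |P|` for the inclusion `ℚ ⊂ ℂ`. [folklore] -/
theorem maxNorm_map_algebraMap_rat {σ : Type*} (P : MvPolynomial σ ℚ) :
    maxNorm (MvPolynomial.map (algebraMap ℚ ℂ) P) = maxNorm P := by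
  classical
  rw [maxNorm_map_eq]
  unfold maxNorm
  congr 1
  exact Finset.sup_congr rfl fun e _ => NNReal.eq (norm_ratCast_eq _)

/-- `|map_ℂ Z| = |map_ℚ Z|` for an integer polynomial. [folklore] -/
theorem maxNorm_map_intCast_eq {σ : Type*} (Z : MvPolynomial σ ℤ) :
    maxNorm (MvPolynomial.map (Int.castRingHom ℂ) Z) =
      maxNorm (MvPolynomial.map (Int.castRingHom ℚ) Z) := by
  have h : MvPolynomial.map (Int.castRingHom ℂ) Z =
      MvPolynomial.map (algebraMap ℚ ℂ) (MvPolynomial.map (Int.castRingHom ℚ) Z) := by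
    rw [map_map, RingHom.ext_int ((algebraMap ℚ ℂ).comp (Int.castRingHom ℚ)) (Int.castRingHom ℂ)]
  rw [h, maxNorm_map_algebraMap_rat]

/-- `#supp (map Z) ≤ #supp Z`-type bookkeeping: the support of an integer polynomial mapped to a
characteristic-zero field is unchanged. [folklore] -/
theorem support_map_intCast {σ : Type*} (Z : MvPolynomial σ ℤ) :
    (MvPolynomial.map (Int.castRingHom ℂ) Z).support = Z.support :=
  support_map_of_injective Z (RingHom.injective_int _)

/-! ### Heights of integer polynomials -/

/-- A rational number which multiplies a primitive family of integers into integers is an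
integer: if `c · a_γ ∈ ℤ` for all `γ` and `gcd(a_γ) = 1` then `c.den = 1`. [folklore] -/
theorem den_eq_one_of_mul_mem {ι : Type*} {s : Finset ι} {a : ι → ℤ} (hgcd : s.gcd a = 1) {c : ℚ}
    (h : ∀ γ ∈ s, ∃ z : ℤ, c * a γ = z) : c.den = 1 := by
  have hdvd : ∀ γ ∈ s, (c.den : ℤ) ∣ a γ := by
    intro γ hγ
    obtain ⟨z, hz⟩ := h γ hγ
    have h1 : (c.num : ℚ) * a γ = z * c.den := by
      have hc : (c : ℚ) = c.num / c.den := (Rat.num_div_den c).symm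
      rw [hc] at hz
      field_simp at hz
      linarith [hz]
    have h2 : c.num * a γ = z * c.den := by exact_mod_cast h1
    have hcop : IsCoprime (c.den : ℤ) c.num := by
      rw [Int.isCoprime_iff_gcd_eq_one, Int.gcd_comm]
      exact_mod_cast c.reduced
    exact hcop.dvd_of_dvd_mul_left ⟨z, by rw [h2]; ring⟩
  have h1 : (c.den : ℤ) ∣ s.gcd a := Finset.dvd_gcd hdvd
  rw [hgcd] at h1
  have h2 : (c.den : ℤ) = 1 := Int.eq_one_of_dvd_one (by positivity) h1
  exact_mod_cast h2

/-- **`h(Z) ≤ log |Z|` for a non-zero integer polynomial** (`|Z|` the maximum modulus of the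
coefficients; equality for primitive `Z`). [cite: NesterenkoPhilippon2001, Ch. 3 §4, remark after
Def. 4.2 (p. 38)] -/
theorem height_map_le_log_maxNorm {σ : Type*} (Z : MvPolynomial σ ℤ) (hZ : Z ≠ 0) :
    height (MvPolynomial.map (Int.castRingHom ℚ) Z) ≤
      Real.log (maxNorm (MvPolynomial.map (Int.castRingHom ℚ) Z)) := by
  classical
  set P := MvPolynomial.map (Int.castRingHom ℚ) Z with hP
  have hP0 : P ≠ 0 :=
    (map_ne_zero_iff (MvPolynomial.map (Int.castRingHom ℚ))
      (map_injective _ (RingHom.injective_int _))).mpr hZ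
  obtain ⟨c, hc, Z₁, hPZ₁, hsupp, hgcd⟩ := exists_eq_C_mul_map_primitive P hP0
  -- `c` is an integer
  have hcden : c.den = 1 := by
    refine den_eq_one_of_mul_mem hgcd fun γ _ => ⟨coeff γ Z, ?_⟩
    have h := congrArg (coeff γ) hPZ₁
    rw [hP, coeff_map, coeff_C_mul, coeff_map] at h
    simp only [eq_intCast] at h
    exact h.symm
  have hc1 : 1 ≤ |c| := by
    have hcnum : (c : ℚ) = c.num := by
      conv_lhs => rw [← Rat.num_div_den c, hcden]
      simp
    have hnum : c.num ≠ 0 := Rat.num_ne_zero.mpr hc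
    rw [hcnum, ← Int.cast_abs]
    exact_mod_cast Int.one_le_abs hnum
  -- the height is that of the primitive part
  have hZ₁0 : Z₁ ≠ 0 := ne_zero_of_gcd_coeff_eq_one hgcd
  have hne : Z₁.support.Nonempty := by
    rw [Finset.nonempty_iff_ne_empty, Ne, support_eq_empty]
    exact hZ₁0
  obtain ⟨γ₀, hγ₀, hmax⟩ := Finset.exists_max_image Z₁.support (fun γ => |coeff γ Z₁|) hne
  rw [hPZ₁, height_C_mul hc, height_map_eq_log_abs_coeff Z₁ hgcd hγ₀ hmax]
  have hpos : (0 : ℝ) < ((|coeff γ₀ Z₁| : ℤ) : ℝ) := by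
    exact_mod_cast abs_pos.mpr (mem_support_iff.mp hγ₀)
  refine Real.log_le_log hpos ?_
  have hk : ((|coeff γ₀ Z₁| : ℤ) : ℝ) = ‖((coeff γ₀ Z₁ : ℤ) : ℚ)‖ := by
    have h1 : ‖((coeff γ₀ Z₁ : ℤ) : ℚ)‖ = ‖(((coeff γ₀ Z₁ : ℤ) : ℚ) : ℝ)‖ :=
      (Rat.norm_cast_real _).symm
    rw [h1, Rat.cast_intCast, Real.norm_eq_abs, Int.cast_abs]
  have hcn : (1 : ℝ) ≤ ‖c‖ := by
    rw [← Rat.norm_cast_real, Real.norm_eq_abs, ← Rat.cast_abs]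
    exact_mod_cast hc1
  calc ((|coeff γ₀ Z₁| : ℤ) : ℝ) = ‖((coeff γ₀ Z₁ : ℤ) : ℚ)‖ := hk
    _ ≤ ‖c‖ * ‖((coeff γ₀ Z₁ : ℤ) : ℚ)‖ := le_mul_of_one_le_left (norm_nonneg _) hcn
    _ = ‖coeff γ₀ (C c * MvPolynomial.map (Int.castRingHom ℚ) Z₁)‖ := by
        rw [coeff_C_mul, coeff_map, eq_intCast, norm_mul]
    _ ≤ maxNorm (C c * MvPolynomial.map (Int.castRingHom ℚ) Z₁) := norm_coeff_le_maxNorm _ _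

/-- **`log |Z| ≤ h(Z)` for a PRIMITIVE integer polynomial** (in fact equality).
[cite: NesterenkoPhilippon2001, Ch. 3 §4, remark after Def. 4.2 (p. 38)] -/
theorem log_maxNorm_map_le_height {σ : Type*} (Z : MvPolynomial σ ℤ)
    (hgcd : Z.support.gcd (fun γ => coeff γ Z) = 1) :
    Real.log (maxNorm (MvPolynomial.map (Int.castRingHom ℚ) Z)) ≤
      height (MvPolynomial.map (Int.castRingHom ℚ) Z) := by
  classical
  have hZ0 : Z ≠ 0 := ne_zero_of_gcd_coeff_eq_one hgcd
  have hne : Z.support.Nonempty := by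
    rw [Finset.nonempty_iff_ne_empty, Ne, support_eq_empty]
    exact hZ0
  obtain ⟨γ₀, hγ₀, hmax⟩ := Finset.exists_max_image Z.support (fun γ => |coeff γ Z|) hne
  rw [height_map_eq_log_abs_coeff Z hgcd hγ₀ hmax]
  have hP0 : MvPolynomial.map (Int.castRingHom ℚ) Z ≠ 0 :=
    (map_ne_zero_iff (MvPolynomial.map (Int.castRingHom ℚ))
      (map_injective _ (RingHom.injective_int _))).mpr hZ0
  refine Real.log_le_log (maxNorm_pos hP0) ?_
  refine maxNorm_le_of_forall_le (by positivity) fun γ hγ => ?_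
  rw [coeff_map, eq_intCast]
  have h1 : ‖((coeff γ Z : ℤ) : ℚ)‖ = (((|coeff γ Z| : ℤ)) : ℝ) := by
    rw [← Rat.norm_cast_real, Rat.cast_intCast, Real.norm_eq_abs, Int.cast_abs]
  rw [h1]
  have hγ' : γ ∈ Z.support := by
    rw [← support_map_of_injective Z (RingHom.injective_int (Int.castRingHom ℚ))]
    exact hγ
  exact_mod_cast hmax γ hγ'

/-! ### `|F(z; ·)| ≤ #supp F · |F|` on the unit polydisc -/

/-- **On the closed unit polydisc `|F(z; ·)| ≤ #supp F · |F|`**: the coefficients of the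
specialised form are values of `F` at points of modulus `≤ 1` (Cauchy's inequality on the torus of
the last group, `exists_eval_ge_maxNorm`). [folklore] -/
theorem maxNorm_map_aeval_splitLast_le {s : ℕ} (F : RU (s + 1) m) {z : Fin s × Fin (m + 1) → ℂ}
    (hz : ∀ w, ‖z w‖ ≤ 1) :
    maxNorm (MvPolynomial.map ((aeval z : RU s m →ₐ[ℚ] ℂ) : RU s m →+* ℂ) (splitLast s m F)) ≤
      F.support.card * maxNorm F := by
  classical
  set P := MvPolynomial.map ((aeval z : RU s m →ₐ[ℚ] ℂ) : RU s m →+* ℂ) (splitLast s m F) with hP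
  obtain ⟨v, hv, hle⟩ := exists_eval_ge_maxNorm P
  refine hle.trans ?_
  rw [hP, eval_map_splitLast, aeval_eq_eval_map]
  have hw : ∀ w, ‖lastCombine (fun w => (aeval z : RU s m →ₐ[ℚ] ℂ) (X w)) v w‖ ≤ 1 := by
    rintro ⟨i, j⟩
    induction i using Fin.lastCases with
    | last => rw [lastCombine_last]; exact (hv j).le
    | cast i => rw [lastCombine_castSucc, aeval_X]; exact hz (i, j)
  refine (norm_eval_le_card_mul_maxNorm _ hw).trans ?_
  rw [maxNorm_map_algebraMap_rat]
  refine mul_le_mul_of_nonneg_right ?_ (maxNorm_nonneg _)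
  exact_mod_cast Finset.card_le_card (support_map_subset _ F)

/-! ### The constant -/

/-- `log (m+1) ≤ 2m/3` for `m ≥ 2`. [folklore] -/
theorem log_succ_le (hm : 2 ≤ m) : Real.log ((m : ℝ) + 1) ≤ 2 * m / 3 := by
  have hm' : (2 : ℝ) ≤ m := by exact_mod_cast hm
  have h1 : (m : ℝ) + 1 ≤ Real.exp (2 * m / 3) := by
    have h := Real.quadratic_le_exp_of_nonneg (x := 2 * (m : ℝ) / 3) (by positivity)
    nlinarith
  calc Real.log ((m : ℝ) + 1) ≤ Real.log (Real.exp (2 * m / 3)) :=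
        Real.log_le_log (by positivity) h1
    _ = 2 * m / 3 := Real.log_exp _

/-- The constant of Proposition 4.11 2): `(s+2) log(m+1) + m ≤ m (s+2)` for `1 ≤ s`, `2 ≤ m`.
[folklore] -/
theorem height_const_le {s : ℕ} (hs : 1 ≤ s) (hm : 2 ≤ m) :
    ((s : ℝ) + 2) * Real.log ((m : ℝ) + 1) + m ≤ (m : ℝ) * (s + 2) := by
  have hs' : (1 : ℝ) ≤ s := by exact_mod_cast hs
  have h := log_succ_le hm
  nlinarith

section Setting

variable {s : ℕ} {𝔭 : Ideal (Rx m)} {Q : Rx m} {d : ℕ} {q : ℚ} {Q₀ : MvPolynomial (Fin (m + 1)) ℤ}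

/-- **LNM 1752 Ch. 3 Proposition 4.11 2) for the `u`-resultant**: for a homogeneous prime `𝔭` of
rank `s + 1` (`2 ≤ s + 1 ≤ m`), `Q ∉ 𝔭` a form of degree `d ≥ 1` with primitive integer model
`Q₀`, and `G = uResultant 𝔭 s d Q₀`:
`h(G) ≤ d · h(𝔭) + deg 𝔭 · h(Q) + m (s+2) · deg 𝔭 · d`.
[cite: NesterenkoPhilippon2001, Ch. 3 Prop. 4.11 2) (p. 41)] -/
theorem height_uResultant_le (hs : 1 ≤ s) (hsm : s + 1 ≤ m) (h𝔭 : 𝔭.IsPrime)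
    (hhom : 𝔭.IsHomogeneous (homogeneousSubmodule (Fin (m + 1)) ℚ))
    (hunm : IsUnmixedOfRank 𝔭 (s + 1)) (hQ : Q.IsHomogeneous d) (hd : 1 ≤ d) (hQ𝔭 : Q ∉ 𝔭)
    (hq : q ≠ 0) (hQQ₀ : Q = C q * MvPolynomial.map (Int.castRingHom ℚ) Q₀)
    (hQ₀ : Q₀.IsHomogeneous d) (hprim : Q₀.support.gcd (fun γ => coeff γ Q₀) = 1) :
    height (uResultant 𝔭 s d Q₀) ≤
      iheight 𝔭 (s + 1) * d + height Q * ideg 𝔭 (s + 1) +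
        (m : ℝ) * (s + 2) * ideg 𝔭 (s + 1) * d := by
  classical
  have hdim : ringKrullDim (Rx m ⧸ 𝔭) = (s + 1 : ℕ) :=
    ringKrullDim_quotient_eq_of_isUnmixedOfRank h𝔭 hunm
  have hm2 : 2 ≤ m := by omega
  have hF0 : chowForm 𝔭 (s + 1) ≠ 0 := chowForm_ne_zero_of_prime h𝔭 hhom hdim
  obtain ⟨hlam, hFlam, -, hgcdF⟩ := chowFormInt_spec hF0
  obtain ⟨G₀, hG₀⟩ := exists_map_eq_normResultant h𝔭 hhom hdim hQ₀ (s := s)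
  rw [normResultant] at hG₀
  have hG0 : uResultant 𝔭 s d Q₀ ≠ 0 := uResultant_ne_zero hs h𝔭 hhom hunm hQ hd hQ𝔭 hQQ₀ hQ₀
  -- names
  set lam := chowFormScalar 𝔭 s with hlamdef
  set D := ideg 𝔭 (s + 1) with hDdef
  have hlampow : lam ^ d ≠ 0 := pow_ne_zero _ hlam
  -- `G = λ^d · map G₀`
  have hGeq : uResultant 𝔭 s d Q₀ = C (lam ^ d) * MvPolynomial.map (Int.castRingHom ℚ) G₀ := by
    rw [hG₀, ← mul_assoc, ← map_mul, ← mul_pow, mul_inv_cancel₀ hlam, one_pow, C_1, one_mul]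
  have hG₀0 : G₀ ≠ 0 := by
    rintro rfl
    rw [map_zero, mul_zero] at hGeq
    exact hG0 hGeq
  -- heights of the models
  have hQ0 : MvPolynomial.map (Int.castRingHom ℚ) Q₀ ≠ 0 := by
    rintro h
    rw [h, mul_zero] at hQQ₀
    exact hQ𝔭 (hQQ₀ ▸ 𝔭.zero_mem)
  have hQ₀0 : Q₀ ≠ 0 := ne_zero_of_gcd_coeff_eq_one hprim
  have hhQ : height Q = height (MvPolynomial.map (Int.castRingHom ℚ) Q₀) := by
    rw [hQQ₀, height_C_mul hq]
  have hhF : iheight 𝔭 (s + 1) = height (MvPolynomial.map (Int.castRingHom ℚ) (chowFormInt 𝔭 s)) := by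
    rw [iheight, hFlam, height_C_mul hlam]
  have hhG : height (uResultant 𝔭 s d Q₀) = height (MvPolynomial.map (Int.castRingHom ℚ) G₀) := by
    rw [hGeq, height_C_mul hlampow]
  -- the three maximum norms `MQ = |Q₀|`, `MF = |F₀|`, `MG = |G₀|`
  set MQ := maxNorm (MvPolynomial.map (Int.castRingHom ℚ) Q₀) with hMQ
  set MF := maxNorm (MvPolynomial.map (Int.castRingHom ℚ) (chowFormInt 𝔭 s)) with hMF
  set MG := maxNorm (MvPolynomial.map (Int.castRingHom ℚ) G₀) with hMG
  have hMQpos : 0 < MQ := maxNorm_pos hQ0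
  have hF₀0 : MvPolynomial.map (Int.castRingHom ℚ) (chowFormInt 𝔭 s) ≠ 0 := by
    intro h
    rw [h, mul_zero] at hFlam
    exact hF0 hFlam
  have hMFpos : 0 < MF := maxNorm_pos hF₀0
  have hMQle : MQ ≤ Real.exp (height Q) := by
    rw [hhQ, ← Real.exp_log hMQpos]
    exact Real.exp_le_exp.mpr (log_maxNorm_map_le_height Q₀ hprim)
  have hMFle : MF ≤ Real.exp (iheight 𝔭 (s + 1)) := by
    rw [hhF, ← Real.exp_log hMFpos]
    exact Real.exp_le_exp.mpr (log_maxNorm_map_le_height _ hgcdF)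
  -- `|G| = |λ|^d MG` and `|F| = |λ| MF`
  have hmaxG : maxNorm (uResultant 𝔭 s d Q₀) = ‖lam‖ ^ d * MG := by
    rw [hGeq, maxNorm_C_mul, norm_pow]
  have hmaxF : maxNorm (chowForm 𝔭 (s + 1)) = ‖lam‖ * MF := by
    rw [hFlam, maxNorm_C_mul]
  have hlamn : 0 < ‖lam‖ := norm_pos_iff.mpr hlam
  -- the archimedean bound for `|G|` at a point of the torus
  obtain ⟨zs, hzs, hle⟩ := exists_eval_ge_maxNorm (MvPolynomial.map (algebraMap ℚ ℂ) (uResultant 𝔭 s d Q₀))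
  have hzs1 : ∀ w, ‖zs w‖ ≤ 1 := fun w => (hzs w).le
  have harch := norm_aeval_uResultant_le h𝔭 hhom hdim hQ₀ zs
  have hsuppQ : (MvPolynomial.map (Int.castRingHom ℂ) Q₀).support.card ≤ (m + 1) ^ d := by
    rw [support_map_intCast]
    exact card_support_le_pow_of_isHomogeneous hQ₀
  have hL1 : l1Norm (MvPolynomial.map (Int.castRingHom ℂ) Q₀) ≤ ((m : ℝ) + 1) ^ d * MQ := by
    refine (l1Norm_le_card_mul_maxNorm _).trans ?_
    rw [maxNorm_map_intCast_eq]
    refine mul_le_mul_of_nonneg_right ?_ (maxNorm_nonneg _)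
    exact_mod_cast hsuppQ
  have hsuppF : ((chowForm 𝔭 (s + 1)).support.card : ℝ) ≤ ((m : ℝ) + 1) ^ ((s + 1) * D) := by
    exact_mod_cast card_support_chowForm_le_pow 𝔭 (Nat.succ_pos s)
  have hspec : maxNorm (MvPolynomial.map ((aeval zs : RU s m →ₐ[ℚ] ℂ) : RU s m →+* ℂ)
      (splitLast s m (chowForm 𝔭 (s + 1)))) ≤ ((m : ℝ) + 1) ^ ((s + 1) * D) * (‖lam‖ * MF) := by
    rw [← hmaxF]
    exact (maxNorm_map_aeval_splitLast_le _ hzs1).trans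
      (mul_le_mul_of_nonneg_right hsuppF (maxNorm_nonneg _))
  -- assemble: `|λ|^d MG ≤ ((m+1)^d MQ)^D (e^{mD} (m+1)^{(s+1)D} |λ| MF)^d`
  have hMGle : ‖lam‖ ^ d * MG ≤ (((m : ℝ) + 1) ^ d * MQ) ^ D *
      (Real.exp ((m : ℝ) * D) * (((m : ℝ) + 1) ^ ((s + 1) * D) * (‖lam‖ * MF))) ^ d := by
    rw [← hmaxG, ← maxNorm_map_algebraMap_rat]
    refine hle.trans ?_
    rw [← aeval_eq_eval_map]
    refine harch.trans ?_
    have hnn : 0 ≤ Real.exp ((m : ℝ) * D) *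
        maxNorm (MvPolynomial.map ((aeval zs : RU s m →ₐ[ℚ] ℂ) : RU s m →+* ℂ)
          (splitLast s m (chowForm 𝔭 (s + 1)))) :=
      mul_nonneg (Real.exp_pos _).le (maxNorm_nonneg _)
    exact mul_le_mul (pow_le_pow_left₀ (l1Norm_nonneg _) hL1 D)
      (pow_le_pow_left₀ hnn (mul_le_mul_of_nonneg_left hspec (Real.exp_pos _).le) d)
      (pow_nonneg hnn d) (by positivity)
  -- divide by `|λ|^d`; the constant factor `K = ((m+1)^d)^D (e^{mD})^d ((m+1)^{(s+1)D})^d`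
  set K : ℝ := (((m : ℝ) + 1) ^ d) ^ D * Real.exp ((m : ℝ) * D) ^ d *
    (((m : ℝ) + 1) ^ ((s + 1) * D)) ^ d with hK
  have hMGle' : MG ≤ MQ ^ D * MF ^ d * K := by
    have hl : 0 < ‖lam‖ ^ d := pow_pos hlamn d
    refine le_of_mul_le_mul_left (hMGle.trans_eq ?_) hl
    rw [hK]
    ring
  -- the constant
  have hm1 : (1 : ℝ) ≤ (m : ℝ) + 1 := by linarith [(Nat.cast_nonneg m : (0 : ℝ) ≤ m)]
  have hm0 : (0 : ℝ) < (m : ℝ) + 1 := by linarith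
  have hconst : K ≤ Real.exp ((m : ℝ) * (s + 2) * D * d) := by
    have hDd : (0 : ℝ) ≤ (D : ℝ) * d := by positivity
    have hlog := height_const_le hs hm2
    have hlog0 : 0 ≤ Real.log ((m : ℝ) + 1) := Real.log_nonneg hm1
    have h1 : (((m : ℝ) + 1) ^ d) ^ D = Real.exp ((D : ℝ) * ((d : ℝ) * Real.log ((m : ℝ) + 1))) := by
      rw [Real.exp_nat_mul, Real.exp_nat_mul, Real.exp_log hm0]
    have h2 : (((m : ℝ) + 1) ^ ((s + 1) * D)) ^ d =
        Real.exp ((d : ℝ) * ((((s + 1) * D : ℕ) : ℝ) * Real.log ((m : ℝ) + 1))) := by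
      rw [Real.exp_nat_mul, Real.exp_nat_mul, Real.exp_log hm0]
    have h3 : Real.exp ((m : ℝ) * D) ^ d = Real.exp ((d : ℝ) * ((m : ℝ) * D)) := by
      rw [← Real.exp_nat_mul]
    rw [hK, h1, h2, h3, ← Real.exp_add, ← Real.exp_add]
    refine Real.exp_le_exp.mpr ?_
    push_cast
    have key : ((D : ℝ) * d) * (((s : ℝ) + 2) * Real.log ((m : ℝ) + 1) + m) ≤
        ((D : ℝ) * d) * ((m : ℝ) * (s + 2)) := mul_le_mul_of_nonneg_left hlog hDd
    nlinarith [key]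
  -- conclude
  rw [hhG]
  refine (height_map_le_log_maxNorm G₀ hG₀0).trans ?_
  rw [← hMG]
  have hMGpos : 0 < MG := maxNorm_pos ((map_ne_zero_iff (MvPolynomial.map (Int.castRingHom ℚ))
      (map_injective _ (RingHom.injective_int _))).mpr hG₀0)
  have hfinal : MG ≤ Real.exp (iheight 𝔭 (s + 1) * d + height Q * D + (m : ℝ) * (s + 2) * D * d) := by
    refine hMGle'.trans ?_
    rw [Real.exp_add, Real.exp_add]
    have e1 : Real.exp (height Q * D) = Real.exp (height Q) ^ D := by rw [← Real.exp_nat_mul]; ring_nf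
    have e2 : Real.exp (iheight 𝔭 (s + 1) * d) = Real.exp (iheight 𝔭 (s + 1)) ^ d := by
      rw [← Real.exp_nat_mul]; ring_nf
    rw [e1, e2]
    calc MQ ^ D * MF ^ d * K
        ≤ Real.exp (height Q) ^ D * Real.exp (iheight 𝔭 (s + 1)) ^ d *
            Real.exp ((m : ℝ) * (s + 2) * D * d) := by
          have hKnn : 0 ≤ K := by rw [hK]; positivity
          exact mul_le_mul (mul_le_mul (pow_le_pow_left₀ hMQpos.le hMQle D)
            (pow_le_pow_left₀ hMFpos.le hMFle d) (by positivity) (by positivity)) hconst hKnn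
            (by positivity)
      _ = _ := by ring
  calc Real.log MG ≤ Real.log (Real.exp (iheight 𝔭 (s + 1) * d + height Q * D +
        (m : ℝ) * (s + 2) * D * d)) := Real.log_le_log hMGpos hfinal
    _ = _ := Real.log_exp _

end Setting

end Nesterenko

end Literature.NumberTheory.Transcendental

end
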